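import Summits.HodgeConjecture.HodgeConjecture.Theorems.R90S9SimilCongrLocalConstituents  -- ★ (B3b) part 1 (p02, p861492): `memXiFamily_of_localCongr`, `comap_isConstituentOf_iff_of_localEquiv`
import Summits.HodgeConjecture.HodgeConjecture.Theorems.R90S9SimilCongrLocalEquiv         -- ★ (B3a)→(B3b) junction (p01, p861645): `exists_localEquiv_of_equivariant`, `exists_similCongr_localEquiv`, `formCongr_toLocalGL_smul` (+ ★ p861490 `formCongr_smul_to_simil`)
import HarnessLib

/-!
# R90-TF · S9 «InnerForm-13.3.6 (c)» — (B3b) END TO END: `MemXiFamily` RIDES THE RATIONAL SIMILITUDE `U(H) ≃ U(H₀)`, `x ↦ B x B⁻¹`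
# (Rogawski 1990 §14.2 pp. 232–234 «we fix an isomorphism `ψ : G′ → G` … the equivalence classes of representations of `G_v` and `G′_v` are canonically identified»; §14.6 p. 246)

Cell `hodgecm-mathlib`, crux H413 (`stmt-HodgeConjecture-24833`), route of record `HCCMUnconditional`; programme R90-TF (brief `director/R90-BRIEF.v2.md`
1f40d54518340a35), section S9 = InnerForm-13.3.6 (c) (base `R90-IF`), seat R90-IF-p02 (g0).  FILE-OWNERSHIP RULING of R90-IF-plan (g0) (R90 bus 2026-09-04T15:57:45Z):
p01 owns `Theorems/R90S9SimilCongrLocalEquiv.lean` ((V1) value laws + (V3) the local `Representation.Equiv`), p02 owns THIS file = the END-TO-END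
`MemXiFamily P … → MemXiFamily P₀ …` for the transported `P₀`, consuming (V1)∕(V3) BY NAME ((V2) «smooth vectors correspond» is p01's ★
`isSmoothVector_finRep_iff_of_equivariant`, cited, not restated).  Helper file, lane `--supports stmt-HodgeConjecture-24833 --as helper`; theorems only (no definition, no
instance, no notation, no named fact, no `sorry`); typed on `adelicGroupData L⁺ L c 3 H` EXACTLY as (B0) `XiMembershipAt` and ★ `MemXiFamily`.
HONEST LABEL: HC_CM is proved only modulo the 7 printed citations (2 remaining named inputs: hLiu418 = stmt-HodgeConjecture-24832, h413 = stmt-HodgeConjecture-24833) until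
rung 0 closes; this file proves no printed GLOBAL statement — it GLUES (B3a) (p01 ★ p861490 ∕ p861645) to (B3b) part 1 (p02 ★ p861492): the sub-socket (B3b) of FILE B's
`sock_S9_similitudeTransport` is thereby CLOSED over ★ with NO residual input; what remains of (B3) is (B3d) (the (B0) data ∕ signed-package transport, p03).

## Contents (all proved; `N = 3`)
* §1 **`comap_isConstituentOf_iff_similCongr`** — `hloc` AS AN IFF: for `ᵗ(σB)·H₀·B = c • H` (`c ≠ 0`), a value-characterised `Φ : U(H)(𝔸) ≃ U(H₀)(𝔸)` (`Φ x = B_𝔸 x B_𝔸⁻¹`) and a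
  `Φ`-equivariant `e : P ≃ P₀`, a class `c₀` of `U(H₀)(L⁺_v)` is a `v`-constituent of `P₀` iff `c₀ ∘ Ad(B_v)` (`IrrClass.comap` along ★ `cmDatumLocalCongr L v (toLocalGL L v B) _ _`,
  for ANY local data `(a_v, hav, hv)` of `B_v` — e.g. multiplier `c`, ★ `formCongr_toLocalGL_smul`) is a `v`-constituent of `P` — ★ `comap_isConstituentOf_iff_of_localEquiv` (part 1 §4) fed with p01's ★
  `exists_localEquiv_of_equivariant` (whose identification binder `ev` is `Ad(B_v)` by `rfl`).
* §2 **`memXiFamily_similCongr`** — `MemXiFamily P hH hHd μω hμu ξ → MemXiFamily P₀ hH₀ hH₀d μω hμu ξ` under the same data: ★ `memXiFamily_of_localCongr` at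
  `T_v := B_v` (any local data `(a_v, hav, hv)`) with `hloc :=` the (⇒) of §1.
* §3 **`exists_similCongr_memXiFamily`** — from (B3)'s OWN binders `formCongr (cmConjRingHom L) B (a • H₀) = H`, `a ≠ 0`, B0's automorphic measure `μ` of `U(H)` and discrete
  `P ⊂ L²(μ)` with `MemXiFamily P hH hHd μω hμu ξ`: THERE EXIST an automorphic measure `μ₀` of `U(H₀)` and a discrete automorphic `P₀ ⊂ L²(μ₀)` with `MemXiFamily P₀ hH₀ hH₀d μω hμu ξ`
  AND the two-way dictionary of `v`-constituents along `Ad(B_v)` (multiplier `a⁻¹`, ★ `formCongr_smul_to_simil`) at every finite `v` — ONE CALL of p01's ★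
  `exists_similCongr_localEquiv` (`Φ`, `Ψ`, `μ₀ = Ψ_* μ`, `P₀ = U(P)`, `e`), then §2 and §1 (`Exists.elim`, not `obtain`: `cases` against goals of this size exhausts heartbeats).
  For (B3): `H₀ := qsForm L`, so a (B0) binder `c` (a `v`-constituent of `P` on `U(H)`) is read as the `v`-constituent `comap e_v⁻¹ c` of `P₀` on `U(Φ₃)` (★ `IrrClass.comap_comap_symm`)
  and (B0) at `Φ₃` applies to it; the disjuncts come back by part 1 §1 `comap_comap_symm_cmDatumLocalCongr_mul`.

## References
* [Rogawski1990] J. D. Rogawski, *Automorphic Representations of Unitary Groups in Three Variables*, Ann. of Math. Stud. 123 (1990): §14.2 pp. 232–234; §13.1 p. 199; §14.6 p. 246; §1.9 p. 8.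
* [PlatonovRapinchuk1994] V. Platonov, A. Rapinchuk, *Algebraic Groups and Number Theory* (1994), §2.3, §5.1.
* [BorelJacquet1979] A. Borel, H. Jacquet, *Automorphic forms and automorphic representations*, Proc. Symp. Pure Math. 33.1 (1979), §4.1, §4.6.
* [BushnellHenniart2006] C. J. Bushnell, G. Henniart, *The Local Langlands Conjecture for GL(2)* (2006), §1.1.
-/

set_option autoImplicit false
-- the mandated namespace repeats the single-problem summit's segment (`HodgeConjecture.HodgeConjecture`)
set_option linter.dupNamespace false

noncomputable section

open NumberField IsDedekindDomain MeasureTheory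
open scoped Matrix MatrixGroups

open Literature.NumberTheory Literature.NumberTheory.Automorphic Literature.NumberTheory.Automorphic.UnitaryGroup
open Literature.NumberTheory.Rogawski1990 Literature.NumberTheory.GaloisRepresentations

namespace Summit.HodgeConjecture.HodgeConjecture.R90.S9

section Glue

variable {L : Type} [Field L] [NumberField L] [IsCMField L] {H₀ H : Matrix (Fin 3) (Fin 3) L}
  {μ : Measure (adelicGroupData (↥(maximalRealSubfield L)) L (IsCMField.complexConj L) 3 H).automorphicQuotient}
  [(adelicGroupData (↥(maximalRealSubfield L)) L (IsCMField.complexConj L) 3 H).IsAutomorphicMeasure μ]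
  {μ₀ : Measure (adelicGroupData (↥(maximalRealSubfield L)) L (IsCMField.complexConj L) 3 H₀).automorphicQuotient}
  [(adelicGroupData (↥(maximalRealSubfield L)) L (IsCMField.complexConj L) 3 H₀).IsAutomorphicMeasure μ₀]
  {P : DiscreteAutomorphicRep (adelicGroupData (↥(maximalRealSubfield L)) L (IsCMField.complexConj L) 3 H) μ}
  {P₀ : DiscreteAutomorphicRep (adelicGroupData (↥(maximalRealSubfield L)) L (IsCMField.complexConj L) 3 H₀) μ₀}

/-! ## §1 `hloc` as an iff along the similitude -/

/-- **THE LOCAL-CONSTITUENT DICTIONARY ALONG `x ↦ B x B⁻¹`.**  For `ᵗ(σB)·H₀·B = c • H` (`c ≠ 0`), `Φ : U(H)(𝔸) ≃ U(H₀)(𝔸)` with `Φ x = B_𝔸 x B_𝔸⁻¹` and a `Φ`-equivariant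
`e : P ≃ P₀` (`e (P(g) w) = P₀(Φ g) (e w)`; p01's (B3a) head supplies both) between discrete automorphic representations of `U(H)` and `U(H₀)`: at every finite `v`, a class `c₀` of
`U(H₀)(L⁺_v)` (read on `localPi` through ★ `localPiEquiv`) is a `v`-constituent of `P₀` IFF `comap e_v c₀` is a `v`-constituent of `P`, `e_v = Ad(B_v) =
cmDatumLocalCongr L v (toLocalGL L v B) (hav v) (hv v)` for ANY local data `ᵗ((σ⊗1)B_v)·(H₀)_v·B_v = a_v • H_v` (e.g. `a_v = c` for `ᵗ(σB)·H₀·B = c • H`, ★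
`formCongr_toLocalGL_smul`).  Part 1 ★ `comap_isConstituentOf_iff_of_localEquiv` at the local equivalences of p01's
★ `exists_localEquiv_of_equivariant` (its value-law binder `hev` holds for `e_v` by `rfl`).  «The equivalence classes of representations of `G_v` and `G′_v` are canonically
identified.» [cite: Rogawski1990, §14.2 pp. 232–234; §13.1 p. 199] [cite: BushnellHenniart2006, §1.1] [cite: PlatonovRapinchuk1994, §2.3] -/
theorem comap_isConstituentOf_iff_similCongr (B : GL (Fin 3) L)
    {av : ∀ v : HeightOneSpectrum (𝓞 ↥(maximalRealSubfield L)), LocalRing L v} (hav : ∀ v, IsUnit (av v))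
    (hv : ∀ v : HeightOneSpectrum (𝓞 ↥(maximalRealSubfield L)),
      formCongr (conjLocal L (IsCMField.complexConj L) v) (toLocalGL L v B) (H₀.map (algebraMap L (LocalRing L v))) =
        av v • H.map (algebraMap L (LocalRing L v)))
    (Φ : (adelicGroupData (↥(maximalRealSubfield L)) L (IsCMField.complexConj L) 3 H).Adelic ≃ₜ*
      (adelicGroupData (↥(maximalRealSubfield L)) L (IsCMField.complexConj L) 3 H₀).Adelic)
    (hΦ : ∀ x : (adelicGroupData (↥(maximalRealSubfield L)) L (IsCMField.complexConj L) 3 H).Adelic,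
      (Subtype.val (Φ x) : GL (Fin 3) (AdeleRing (𝓞 L) L)) = toAdeleGL L B * (Subtype.val x : GL (Fin 3) (AdeleRing (𝓞 L) L)) * (toAdeleGL L B)⁻¹)
    (e : P.space.toSubmodule ≃L[ℂ] P₀.space.toSubmodule)
    (he : ∀ (g : (adelicGroupData (↥(maximalRealSubfield L)) L (IsCMField.complexConj L) 3 H).Adelic) (w : P.space.toSubmodule),
      e (P.space.toContRep g w) = P₀.space.toContRep (Φ g) (e w))
    (v : HeightOneSpectrum (𝓞 ↥(maximalRealSubfield L))) (c₀ : IrrClass ((cmDatum L 3 H₀).Local v)) :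
    (IrrClass.comap (localPiEquiv L (IsCMField.complexConj L) 3 H₀ v) c₀).IsConstituentOf
        (P₀.finRep.smoothPart.toRepresentation.comp
          (inclPlace (↥(maximalRealSubfield L)) L (IsCMField.complexConj L) 3 H₀ v)) ↔
      (IrrClass.comap (localPiEquiv L (IsCMField.complexConj L) 3 H v)
          (IrrClass.comap (cmDatumLocalCongr L v (toLocalGL L v B) (hav v) (hv v)) c₀)).IsConstituentOf
        (P.finRep.smoothPart.toRepresentation.comp
          (inclPlace (↥(maximalRealSubfield L)) L (IsCMField.complexConj L) 3 H v)) :=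
  comap_isConstituentOf_iff_of_localEquiv (fun w => cmDatumLocalCongr L w (toLocalGL L w B) (hav w) (hv w))
    (fun w => Classical.choose (exists_localEquiv_of_equivariant B Φ hΦ P P₀ e he w _ (fun _ => rfl))) v c₀

/-! ## §2 `MemXiFamily` along the similitude -/

/-- **(B3b) `MemXiFamily` RIDES THE SIMILITUDE.**  Under the data of `comap_isConstituentOf_iff_similCongr`, for `H₀, H` hermitian with unit determinants:
`MemXiFamily P hH hHd μω hμu ξ → MemXiFamily P₀ hH₀ hH₀d μω hμu ξ` — part 1 ★ `memXiFamily_of_localCongr` at `T_v := B_v` (any local data) with `hloc :=` the (⇒) of §1.  «`Π′(ξ) =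
⊗ Π′(ξ_v)`, `Π′(ξ_v) = Π(ξ_v)` for finite `v`.» [cite: Rogawski1990, §14.2 pp. 232–234; §14.6 p. 246; §13.1 p. 199] [cite: PlatonovRapinchuk1994, §2.3] -/
theorem memXiFamily_similCongr (hH₀ : (H₀.map (cmConjRingHom L))ᵀ = H₀) (hH₀d : IsUnit H₀.det)
    (hH : (H.map (cmConjRingHom L))ᵀ = H) (hHd : IsUnit H.det) (B : GL (Fin 3) L)
    (av : ∀ v : HeightOneSpectrum (𝓞 ↥(maximalRealSubfield L)), LocalRing L v) (hav : ∀ v, IsUnit (av v))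
    (hv : ∀ v : HeightOneSpectrum (𝓞 ↥(maximalRealSubfield L)),
      formCongr (conjLocal L (IsCMField.complexConj L) v) (toLocalGL L v B) (H₀.map (algebraMap L (LocalRing L v))) =
        av v • H.map (algebraMap L (LocalRing L v)))
    (Φ : (adelicGroupData (↥(maximalRealSubfield L)) L (IsCMField.complexConj L) 3 H).Adelic ≃ₜ*
      (adelicGroupData (↥(maximalRealSubfield L)) L (IsCMField.complexConj L) 3 H₀).Adelic)
    (hΦ : ∀ x : (adelicGroupData (↥(maximalRealSubfield L)) L (IsCMField.complexConj L) 3 H).Adelic,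
      (Subtype.val (Φ x) : GL (Fin 3) (AdeleRing (𝓞 L) L)) = toAdeleGL L B * (Subtype.val x : GL (Fin 3) (AdeleRing (𝓞 L) L)) * (toAdeleGL L B)⁻¹)
    (e : P.space.toSubmodule ≃L[ℂ] P₀.space.toSubmodule)
    (he : ∀ (g : (adelicGroupData (↥(maximalRealSubfield L)) L (IsCMField.complexConj L) 3 H).Adelic) (w : P.space.toSubmodule),
      e (P.space.toContRep g w) = P₀.space.toContRep (Φ g) (e w))
    {μω : HeckeCharacter L} {hμu : μω.IsUnitary} {ξ : OneDimAutRepH L}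
    (hmem : MemXiFamily P hH hHd μω hμu ξ) : MemXiFamily P₀ hH₀ hH₀d μω hμu ξ :=
  memXiFamily_of_localCongr hH₀ hH₀d hH hHd (fun v => toLocalGL L v B) av hav hv
    (fun v c₀ h => (comap_isConstituentOf_iff_similCongr B hav hv Φ hΦ e he v c₀).1 h) hmem

end Glue

/-! ## §3 End to end from (B3)'s binders -/

section EndToEnd

variable {L : Type} [Field L] [NumberField L] [IsCMField L] {H₀ H : Matrix (Fin 3) (Fin 3) L}

/-- **(B3a)+(B3b) END TO END over ★, from (B3)'s own binders.**  Let `H₀, H ∈ M₃(L)` be hermitian with unit determinants and `formCongr (cmConjRingHom L) B (a • H₀) = H`,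
`a ≠ 0` (for (B3): `H₀ = qsForm L`).  For every automorphic measure `μ` of `U(H)` and every discrete automorphic `P ⊂ L²(μ)` (typed as in (B0) `XiMembershipAt`) with
`MemXiFamily P hH hHd μω hμu ξ` THERE EXIST an automorphic measure `μ₀` of `U(H₀)` and a discrete automorphic `P₀ ⊂ L²(μ₀)` with `MemXiFamily P₀ hH₀ hH₀d μω hμu ξ`, whose
`v`-constituents correspond to those of `P` along `e_v = Ad(B_v) = cmDatumLocalCongr L v (toLocalGL L v B) _ _` (multiplier `a⁻¹`, ★ `formCongr_smul_to_simil`) IN BOTH DIRECTIONS at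
every finite `v`.  ONE CALL of p01's ★ `exists_similCongr_localEquiv` (`Φ`, `Ψ`, `μ₀ = Ψ_* μ`, `P₀ = U(P)`, `Φ`-equivariant `e`), then §2 and §1.  = FILE B's
`sock_S9_similitudeTransport` MINUS (B3d).  [cite: Rogawski1990, §14.2 pp. 232–234; §14.6 p. 246] [cite: BorelJacquet1979, §4.1, §4.6] [cite: PlatonovRapinchuk1994, §2.3, §5.1] -/
theorem exists_similCongr_memXiFamily (hH₀ : (H₀.map (cmConjRingHom L))ᵀ = H₀) (hH₀d : IsUnit H₀.det)
    (hH : (H.map (cmConjRingHom L))ᵀ = H) (hHd : IsUnit H.det)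
    (B : GL (Fin 3) L) {a : L} (ha0 : a ≠ 0) (hB : formCongr (cmConjRingHom L) B (a • H₀) = H)
    (μ : Measure (adelicGroupData (↥(maximalRealSubfield L)) L (IsCMField.complexConj L) 3 H).automorphicQuotient)
    [(adelicGroupData (↥(maximalRealSubfield L)) L (IsCMField.complexConj L) 3 H).IsAutomorphicMeasure μ]
    (P : DiscreteAutomorphicRep (adelicGroupData (↥(maximalRealSubfield L)) L (IsCMField.complexConj L) 3 H) μ)
    {μω : HeckeCharacter L} {hμu : μω.IsUnitary} {ξ : OneDimAutRepH L} (hmem : MemXiFamily P hH hHd μω hμu ξ) :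
    ∃ (μ₀ : Measure (adelicGroupData (↥(maximalRealSubfield L)) L (IsCMField.complexConj L) 3 H₀).automorphicQuotient)
      (_ : (adelicGroupData (↥(maximalRealSubfield L)) L (IsCMField.complexConj L) 3 H₀).IsAutomorphicMeasure μ₀)
      (P₀ : DiscreteAutomorphicRep (adelicGroupData (↥(maximalRealSubfield L)) L (IsCMField.complexConj L) 3 H₀) μ₀),
      MemXiFamily P₀ hH₀ hH₀d μω hμu ξ ∧
      ∀ (v : HeightOneSpectrum (𝓞 ↥(maximalRealSubfield L))) (c₀ : IrrClass ((cmDatum L 3 H₀).Local v)),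
        (IrrClass.comap (localPiEquiv L (IsCMField.complexConj L) 3 H₀ v) c₀).IsConstituentOf
            (P₀.finRep.smoothPart.toRepresentation.comp
              (inclPlace (↥(maximalRealSubfield L)) L (IsCMField.complexConj L) 3 H₀ v)) ↔
          (IrrClass.comap (localPiEquiv L (IsCMField.complexConj L) 3 H v)
              (IrrClass.comap (cmDatumLocalCongr L v (toLocalGL L v B)
                ((IsUnit.mk0 a⁻¹ (inv_ne_zero ha0)).map (algebraMap L (LocalRing L v)))
                (formCongr_toLocalGL_smul L 3 H₀ H B (formCongr_smul_to_simil (cmConjRingHom L) B ha0 H₀ H hB) v)) c₀)).IsConstituentOf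
            (P.finRep.smoothPart.toRepresentation.comp
              (inclPlace (↥(maximalRealSubfield L)) L (IsCMField.complexConj L) 3 H v)) := by
  -- (`Exists.elim` rather than `obtain`: `cases` against this goal exhausts the heartbeat budget)
  refine (exists_similCongr_localEquiv L 3 H₀ H B ha0 hB μ P).elim fun Φ h => h.elim fun Ψ h => h.elim fun hμ₀ h => h.elim fun P₀ h =>
    h.elim fun e h => ?_
  haveI := hμ₀
  exact ⟨μ.map Ψ, hμ₀, P₀,
    memXiFamily_similCongr hH₀ hH₀d hH hHd B _ (fun v => (IsUnit.mk0 a⁻¹ (inv_ne_zero ha0)).map (algebraMap L (LocalRing L v)))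
      (fun v => formCongr_toLocalGL_smul L 3 H₀ H B (formCongr_smul_to_simil (cmConjRingHom L) B ha0 H₀ H hB) v) Φ h.1 e h.2.2.2.2.1 hmem,
    fun v c₀ => comap_isConstituentOf_iff_similCongr B (fun v => (IsUnit.mk0 a⁻¹ (inv_ne_zero ha0)).map (algebraMap L (LocalRing L v)))
      (fun v => formCongr_toLocalGL_smul L 3 H₀ H B (formCongr_smul_to_simil (cmConjRingHom L) B ha0 H₀ H hB) v) Φ h.1 e h.2.2.2.2.1 v c₀⟩

end EndToEnd

end Summit.HodgeConjecture.HodgeConjecture.R90.S9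

end
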